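import Literature.NumberTheory.Automorphic.ShimuraCurveRibetTakahashiLevelOneAssemblyProofs
import Literature.NumberTheory.DiophantineGeometry.GeneralizedFermatTwoPowerCoefficientFreyProofs
import Literature.NumberTheory.DiophantineGeometry.MinimalDiscriminantFactorizationProofs
import Literature.NumberTheory.EllipticCurves.FermatQuarticDescent
import HarnessLib

/-!
# Pasten's Thm. 6.1 (b): the Diophantine inputs of class (b.2) — Lemma 6.10 at `ℓ = 2` PROVED by
# Fermat's quartic descents, Lemma 6.12 for `ℓ ≥ 5` from Wiles–Ribet–Darmon–Merel

Topic `NumberTheory/Automorphic`; a proofs-only companion (theorems only: no definition, no named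
fact, nothing restated; D-0026) of `ShimuraCurveRibetTakahashi.lean`, written by the seat of its
named fact `Literature.NumberTheory.Automorphic.PastenShimura2024_thm_6_1_b` (H. Pasten, *Shimura
curves and the abc conjecture*, J. Number Theory 254 (2024) 214–335 = arXiv:1705.09251, Thm. 6.1 (b)
p. 20), after `ShimuraCurveRibetTakahashiCokernelProofs.lean` (Pasten's §6.6–6.9 performed in the
tree) and `ShimuraCurveRibetTakahashiLevelOneAssemblyProofs.lean` (the finest assembly
`PastenShimura2024_thm_6_1_b_of_ribetTakahashi_treeFacts'`).

**The point.** In the proof of Thm. 6.17 (p. 24), case (ii) (Frey–Hellegouarch curves `E_{a,b,c}`,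
`M` with two odd primes), Pasten needs for every prime `ℓ` an odd prime `r ∣ N` with `ℓ^α ∤ c_r(E)`
for a fixed `α = α(ℓ)`, up to finitely many exceptional curves: "we apply Lemma 6.12 instead of
Lemma 6.11, and then we apply Lemma 6.10 using the finite set of primes `S = {2}`". In the tree's
assembly `…_treeFacts'` these were the two hypotheses WITHOUT a declaration in the tree:

* (`h610`) Lemma 6.10 at `S ∋ 2`, `L = 8` — used only at `ℓ = 2`: finiteness of the curves
  semistable away from `S` with `|Δ_min| = n · k⁸`, `n` an `S`-unit (Darmon–Granville 1995, Thm. 2,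
  via Faltings' theorem; ineffective);
* (`h612`) Lemma 6.12 — used at every odd `ℓ`: for `(a,b,c) ≠ (1,1,2)` the odd part of `Δ_{E_{a,b,c}}`
  is not a perfect `ℓ`-th power (Wiles; Ribet 1997, Thm. 3; Darmon–Merel 1997).

This file DISCHARGES the first outright and reduces the second, for `ℓ ≥ 5`, to statements that ARE
declarations (Mathlib's `FermatLastTheorem`; the tree's named facts
`Literature.NumberTheory.DiophantineGeometry.ribet1997_twoPowerFermat` and
`Literature.NumberTheory.DiophantineGeometry.darmonMerel1997_denesEquation`), leaving of the whole
Diophantine side of Thm. 6.1 (b) exactly the case `ℓ = 3` of Lemma 6.12 — Euler's `x³ + y³ = 2z³`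
and Legendre's `x³ + y³ = 4z³`, classical but absent from Mathlib and the tree — as a hypothesis.

**Why Lemma 6.10 is provable at `ℓ = 2` for Frey curves (a genuinely shorter road than the printed
appeal to Darmon–Granville).** What Thm. 6.17 (ii) consumes at `ℓ = 2` is: some odd `r ∣ N` has
`8 ∤ c_r(E) = v_r(Δ_E) = 2 v_r(abc)` (Serre 1987, (4.1.9); tree
`ordMinimalDiscriminant_freyCurve_of_ne_two`), i.e. *the odd part of `abc` is not a perfect fourth
power*. If it were, the odd parts of the pairwise coprime `a, b, c` would be fourth powers and
`a + b = c` would read `u⁴ + v⁴ = 2^e w⁴` (`c` even) or `w⁴ − v⁴ = 2^e u⁴` (`a` or `b` even) with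
`uvw ≠ 0`, `e ≥ 1`; writing `2^e = 2^{e mod 2} (2^{⌊e/2⌋})²` these are `x⁴ ± y⁴ = z²` (Fermat:
Mathlib's `not_fermat_42`, Hardy–Wright Thm. 226, and the tree's
`fermat_fourth_pow_sub_fourth_pow_ne_sq`, Koshy Thm. 13.3) or `x⁴ ± y⁴ = 2z²`, which the identities
`(x⁴+y⁴)² − (x⁴−y⁴)² = 4x⁴y⁴` reduce to the former two (`z⁴ − (xy)⁴ = ((x⁴−y⁴)/2)²`, resp.
`z⁴ + (xy)⁴ = ((x⁴+y⁴)/2)²`); the only survivor is `u⁴ = v⁴`, i.e. `a = b = 1`, excluded because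
`N` has an odd prime. So NO exceptional curve occurs and the statement is effective.

## Contents (all sorry-free)

* §I `pow_four_eq_of_add_eq_two_mul_sq` (`x⁴ + y⁴ = 2z²`, `xy ≠ 0` ⟹ `x⁴ = y⁴`),
  `pow_four_sub_pow_four_ne_two_mul_sq` (`x⁴ − y⁴ ≠ 2z²` for `xyz ≠ 0`) — Euler/Legendre, from
  Fermat's two quartic theorems.
* §II `eq_one_of_ordCompl_two_mul_eq_pow_four` — `a + b = c` coprime positive with odd part of
  `abc` a fourth power ⟹ `a = b = 1`.
* §III `factorization_minimalDiscriminantNorm_freyCurve_of_ne_two` (`v_r(Δ_min) = 2 v_r(abc)`, odd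
  `r`) and **`IsFreyHellegouarch.ordCompl_two_minimalDiscriminantNorm_ne_pow_eight`** — the rôle of
  Lemma 6.10 at `ℓ = 2` in Thm. 6.17 (ii), PROVED: for a Frey–Hellegouarch `W` with an odd bad
  prime, the odd part of `|Δ_min(W)|` is not a perfect `8`-th power.
* §IV `eq_one_and_trivial_of_fermatTwoPower`, `eq_one_of_ordCompl_two_mul_eq_pow_prime`,
  **`IsFreyHellegouarch.ordCompl_two_minimalDiscriminantNorm_ne_pow_of_five_le`** — Lemma 6.12 for
  prime `ℓ ≥ 5` from `FermatLastTheoremFor ℓ`, `ribet1997_twoPowerFermat`,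
  `darmonMerel1997_denesEquation`, by the printed trichotomy `m = 0` / `1 < m < ℓ` / `m = 1`.
* §V `PastenShimura2024_thm_6_1_b_of_ribetTakahashi_mestreOesterle_fermatQuartic` — the tree's
  `PastenShimura2024_thm_6_1_b_of_ribetTakahashi_mestreOesterle` WITHOUT `h610` (the witness family
  of `PastenShimura2024_thm_6_17_of_witnesses` is now empty at every prime); and
  **`PastenShimura2024_thm_6_1_b_of_ribetTakahashi_treeFacts''`** — the finest assembly: Thm. 6.1 (b)
  from the named facts `mazurKenku_exists_cyclic_isogeny`, `mestreOesterle1989_thm_1`,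
  `nonempty_shimuraParametrizationData`, `ribet1997_twoPowerFermat`,
  `darmonMerel1997_denesEquation`, Mathlib's statement `FermatLastTheorem`, the component-group
  package (`cI cJ hI hJ h613 hJc hEis h67`, no vocabulary in the tree) and Lemma 6.12 at `ℓ = 3`
  (`h612₃`). Compared with `…_treeFacts'`: `h610` is GONE, `h612` is split into three declarations
  and its `ℓ = 3` residue.

## References

* H. Pasten, *Shimura curves and the abc conjecture*, J. Number Theory 254 (2024) 214–335 =
  arXiv:1705.09251: Thm. 6.1 (b) p. 20; Lemmas 6.9–6.12 p. 23; Thm. 6.17 p. 24 (proof, case (ii));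
  §6.9 p. 25 (held arXiv text, read). [PastenShimura2024]
* G. H. Hardy, E. M. Wright, *An Introduction to the Theory of Numbers*, 6th ed., Thm. 226
  (`x⁴ + y⁴ = z²`; Mathlib `not_fermat_42`). [HardyWright2008]
* T. Koshy, *Elementary Number Theory with Applications* (2001), Thm. 13.3 (`x⁴ − y⁴ = z²`; tree
  `fermat_fourth_pow_sub_fourth_pow_ne_sq`). [Koshy2001]
* K. A. Ribet, *On the equation `a^p + 2^α b^p + c^p = 0`*, Acta Arith. 79 (1997), Thm. 3.
  [Ribet1997] H. Darmon, L. Merel, J. reine angew. Math. 490 (1997), Main Theorem (1).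
  [DarmonMerel1997] H. Darmon, A. Granville, Bull. LMS 27 (1995), Thm. 2 (the input made
  unnecessary at `ℓ = 2`). [DarmonGranville1995]
* J.-P. Serre, Duke Math. J. 54 (1987), §4.1 (4.1.9) (`v_l(Δ) = 2 v_l(ABC)`, `l ≠ 2`). [Serre1987]

## Mathlib / tree search

Mathlib: `not_fermat_42`, `fermatLastTheoremFor_iff_int`, `exists_eq_pow_of_mul_eq_pow`,
`Nat.ordProj_mul_ordCompl_eq_self`, `Nat.ordCompl_mul`, `Nat.factorization_ordCompl`; no
`x⁴ ± y⁴ = 2z²`, no `x³ + y³ = 2z³ / 4z³` (`lean search`). Tree (reused):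
`fermat_fourth_pow_sub_fourth_pow_ne_sq` (`EllipticCurves/FermatQuarticDescent`),
`ordMinimalDiscriminant_freyCurve_of_ne_two`, `WeierstrassCurve.factorization_minimalDiscriminantNorm_holds`,
`WeierstrassCurve.minimalDiscriminantNorm_smul_rat`, `WeierstrassCurve.natGenerator_primesEquiv_symm`,
`exists_eq_mul_pow_of_dvd_factorization`, `fermatInput_of_isSemistable`,
`fermatInput_of_isFreyHellegouarch`, `factorization_minimalDiscriminantNorm_pos_of_dvd`,
`not_sq_dvd_conductorNorm_of_isSemistable`, `not_sq_dvd_conductorNorm_of_isFreyHellegouarch`,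
`PastenShimura2024_thm_6_17_of_witnesses`, `PastenShimura2024_thm_6_1_b_of_prop_6_13_bounded_of_lemma_6_8`,
`PastenShimura2024_lemma_6_14`, `lemma_6_8_factorization_form`,
`PastenShimura2024_lemma_6_8_of_mazurKenku'`, `ShimuraParametrizationData.IsMinimalFor.deg_dvd_modularDegree`,
`nonempty_shimuraCurveData_holds`. The Serre-normalised `factorization_minimalDiscriminantNorm_freyCurve_serre`
(`a ≡ −1 (4)`, `32 ∣ b`) does not apply to `IsFreyHellegouarch` (no congruence conditions), whence §III's
odd-prime form.
-/

noncomputable section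

open scoped MatrixGroups ModularForm

namespace Literature.NumberTheory.Automorphic

open Literature.NumberTheory.EllipticCurves (freyCurve fermat_fourth_pow_sub_fourth_pow_ne_sq
  mazurKenku_exists_cyclic_isogeny mestreOesterle1989_thm_1)
open Literature.NumberTheory.EllipticCurves.ModularForms (ModularParametrizationData IsNewformOf
  PastenShimura2024_lemma_6_8_of_mazurKenku')
open Literature.NumberTheory.DiophantineGeometry (ordMinimalDiscriminant_freyCurve_of_ne_two
  ribet1997_twoPowerFermat darmonMerel1997_denesEquation)

/-! ## I. Euler–Legendre: `x⁴ ± y⁴ = 2z²` from Fermat's `x⁴ ± y⁴ = z²` -/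

/-- **`x⁴ + y⁴ = 2z²` forces `x⁴ = y⁴`** (for `xy ≠ 0`; Euler/Legendre). From
`(x⁴+y⁴)² − (x⁴−y⁴)² = 4x⁴y⁴`: `z⁴ − (xy)⁴ = ((x⁴ − y⁴)/2)²` (`x⁴ − y⁴ = 2z² − 2y⁴` is even), which
contradicts Fermat's theorem on `X⁴ − Y⁴ = Z²` (tree `fermat_fourth_pow_sub_fourth_pow_ne_sq`,
Koshy Thm. 13.3) unless `x⁴ = y⁴`. [folklore] -/
theorem pow_four_eq_of_add_eq_two_mul_sq {x y z : ℤ} (hx : x ≠ 0) (hy : y ≠ 0)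
    (h : x ^ 4 + y ^ 4 = 2 * z ^ 2) : x ^ 4 = y ^ 4 := by
  by_contra hne
  have h2 : (2 : ℤ) ∣ x ^ 4 - y ^ 4 := by
    have : x ^ 4 - y ^ 4 = 2 * (z ^ 2 - y ^ 4) := by linear_combination h
    exact ⟨_, this⟩
  obtain ⟨w, hw⟩ := h2
  have key : z ^ 4 - (x * y) ^ 4 = w ^ 2 := by
    have h4 : (4 : ℤ) * (z ^ 4 - (x * y) ^ 4) = 4 * w ^ 2 := by
      linear_combination -(x ^ 4 + y ^ 4 + 2 * z ^ 2) * h + (x ^ 4 - y ^ 4 + 2 * w) * hw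
    exact mul_left_cancel₀ (by norm_num : (4 : ℤ) ≠ 0) h4
  have hw0 : w ≠ 0 := by
    rintro rfl
    apply hne
    linear_combination hw
  exact fermat_fourth_pow_sub_fourth_pow_ne_sq (mul_ne_zero hx hy) hw0 key

/-- **`x⁴ − y⁴ = 2z²` has no solution with `xyz ≠ 0`** (Euler/Legendre). From
`(x⁴−y⁴)² + 4x⁴y⁴ = (x⁴+y⁴)²`: `z⁴ + (xy)⁴ = ((x⁴ + y⁴)/2)²` (`x⁴ + y⁴ = 2z² + 2y⁴` is even),
contradicting Fermat's `X⁴ + Y⁴ ≠ Z²` (Mathlib `not_fermat_42`, Hardy–Wright Thm. 226). [folklore] -/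
theorem pow_four_sub_pow_four_ne_two_mul_sq {x y z : ℤ} (hx : x ≠ 0) (hy : y ≠ 0) (hz : z ≠ 0) :
    x ^ 4 - y ^ 4 ≠ 2 * z ^ 2 := by
  intro h
  have h2 : (2 : ℤ) ∣ x ^ 4 + y ^ 4 := by
    have : x ^ 4 + y ^ 4 = 2 * (z ^ 2 + y ^ 4) := by linear_combination h
    exact ⟨_, this⟩
  obtain ⟨t, ht⟩ := h2
  have key : z ^ 4 + (x * y) ^ 4 = t ^ 2 := by
    have h4 : (4 : ℤ) * (z ^ 4 + (x * y) ^ 4) = 4 * t ^ 2 := by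
      linear_combination -(x ^ 4 - y ^ 4 + 2 * z ^ 2) * h + (x ^ 4 + y ^ 4 + 2 * t) * ht
    exact mul_left_cancel₀ (by norm_num : (4 : ℤ) ≠ 0) h4
  exact not_fermat_42 hz (mul_ne_zero hx hy) key

/-! ## II. `a + b = c` with the odd part of `abc` a fourth power -/

/-- Pairwise coprime naturals whose product is an `n`-th power are `n`-th powers (unique
factorisation; Mathlib's `exists_eq_pow_of_mul_eq_pow` applied to `x · (yz)`, `y · (xz)`, `z · (xy)`).
[folklore] -/
private theorem exists_eq_pow_three_of_coprime {x y z t n : ℕ} (hxy : x.Coprime y)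
    (hxz : x.Coprime z) (hyz : y.Coprime z) (h : x * y * z = t ^ n) :
    (∃ u, x = u ^ n) ∧ (∃ v, y = v ^ n) ∧ (∃ w, z = w ^ n) := by
  have cop : ∀ {a b : ℕ}, a.Coprime b → IsUnit (gcd a b) := fun hab => Nat.isUnit_iff.mpr hab
  refine ⟨?_, ?_, ?_⟩
  · exact exists_eq_pow_of_mul_eq_pow (cop (hxy.mul_right hxz)) (by rw [← h]; ring)
  · exact exists_eq_pow_of_mul_eq_pow (cop (hxy.symm.mul_right hyz)) (by rw [← h]; ring)
  · exact exists_eq_pow_of_mul_eq_pow (cop (hxz.symm.mul_right hyz.symm)) (by rw [← h]; ring)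

/-- The odd part of an odd number is itself (`v₂(n) = 0`). [folklore] -/
private theorem ordCompl_two_eq_self_of_odd {n : ℕ} (hn : Odd n) : ordCompl[2] n = n := by
  have h2 : ¬ 2 ∣ n := fun h => by
    obtain ⟨k, rfl⟩ := h
    exact (Nat.not_even_iff_odd.mpr hn) (even_two_mul k)
  have : n.factorization 2 = 0 := Nat.factorization_eq_zero_of_not_dvd h2
  conv_rhs => rw [← Nat.ordProj_mul_ordCompl_eq_self n 2]
  rw [this, pow_zero, one_mul]

/-- `2^e = 2^{e mod 2} · (2^{⌊e/2⌋})²` in `ℤ`. [folklore] -/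
private theorem two_pow_eq_mod_mul_sq (e : ℕ) : (2 : ℤ) ^ e = 2 ^ (e % 2) * (2 ^ (e / 2)) ^ 2 := by
  rw [← pow_mul, ← pow_add]
  congr 1
  omega

/-- **`u⁴ + v⁴ = 2^e w⁴` (`uvw ≠ 0`) forces `u⁴ = v⁴`**: for `e` even it is `x⁴ + y⁴ = z²`
(`not_fermat_42`), for `e` odd `x⁴ + y⁴ = 2z²` (`pow_four_eq_of_add_eq_two_mul_sq`). [folklore] -/
private theorem pow_four_eq_of_add_eq_two_pow_mul {u v w : ℤ} {e : ℕ} (hu : u ≠ 0) (hv : v ≠ 0)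
    (hw : w ≠ 0) (h : u ^ 4 + v ^ 4 = 2 ^ e * w ^ 4) : u ^ 4 = v ^ 4 := by
  rw [two_pow_eq_mod_mul_sq e] at h
  have hz : (2 : ℤ) ^ (e / 2) * w ^ 2 ≠ 0 := by positivity
  rcases Nat.mod_two_eq_zero_or_one e with h0 | h1
  · rw [h0, pow_zero, one_mul] at h
    exact absurd (by linear_combination h : u ^ 4 + v ^ 4 = (2 ^ (e / 2) * w ^ 2) ^ 2)
      (not_fermat_42 hu hv)
  · rw [h1, pow_one] at h
    exact pow_four_eq_of_add_eq_two_mul_sq hu hv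
      (by linear_combination h : u ^ 4 + v ^ 4 = 2 * (2 ^ (e / 2) * w ^ 2) ^ 2)

/-- **`w⁴ − v⁴ = 2^e u⁴` is impossible for `uvw ≠ 0`**: for `e` even it is `x⁴ − y⁴ = z²`
(`fermat_fourth_pow_sub_fourth_pow_ne_sq`), for `e` odd `x⁴ − y⁴ = 2z²`
(`pow_four_sub_pow_four_ne_two_mul_sq`). [folklore] -/
private theorem false_of_pow_four_sub_eq_two_pow_mul {u v w : ℤ} {e : ℕ} (hu : u ≠ 0) (hv : v ≠ 0)
    (hw : w ≠ 0) (h : w ^ 4 - v ^ 4 = 2 ^ e * u ^ 4) : False := by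
  rw [two_pow_eq_mod_mul_sq e] at h
  have hz : (2 : ℤ) ^ (e / 2) * u ^ 2 ≠ 0 := by positivity
  rcases Nat.mod_two_eq_zero_or_one e with h0 | h1
  · rw [h0, pow_zero, one_mul] at h
    exact fermat_fourth_pow_sub_fourth_pow_ne_sq hv hz
      (by linear_combination h : w ^ 4 - v ^ 4 = (2 ^ (e / 2) * u ^ 2) ^ 2)
  · rw [h1, pow_one] at h
    exact pow_four_sub_pow_four_ne_two_mul_sq hw hv hz
      (by linear_combination h : w ^ 4 - v ^ 4 = 2 * (2 ^ (e / 2) * u ^ 2) ^ 2)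

/-- **If `a + b = c` with `a, b > 0` coprime and the odd part of `abc` is a perfect fourth power, then
`a = b = 1`.** The odd parts of the pairwise coprime `a, b, c` are fourth powers `u⁴, v⁴, w⁴`
(`exists_eq_pow_three_of_coprime`, the odd part being multiplicative, `Nat.ordCompl_mul`); exactly
one of `a, b, c` is even, `= 2^e ·` its odd part; `a` or `b` even gives `w⁴ − v⁴ = 2^e u⁴`
(impossible, `false_of_pow_four_sub_eq_two_pow_mul`), `c` even gives `u⁴ + v⁴ = 2^e w⁴`, whence
`u⁴ = v⁴`, `a = b`, and coprimality forces `a = b = 1`. This is the arithmetic of Pasten's proof of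
Lemma 6.12 (p. 23: "the odd parts of them are perfect `ℓ`-th powers. Exactly one of `a,b,c` is
even") run with the exponent `4` and Fermat's quartic theorems in place of Wiles–Ribet–Darmon–Merel.
[folklore] -/
theorem eq_one_of_ordCompl_two_mul_eq_pow_four {a b t : ℕ} (ha : 0 < a) (hb : 0 < b)
    (hab : a.Coprime b) (h : ordCompl[2] (a * b * (a + b)) = t ^ 4) : a = 1 ∧ b = 1 := by
  have hac : a.Coprime (a + b) := Nat.coprime_self_add_right.mpr hab
  have hbc : b.Coprime (a + b) := Nat.coprime_add_self_right.mpr hab.symm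
  rw [Nat.ordCompl_mul, Nat.ordCompl_mul] at h
  have hd : ∀ {m n : ℕ}, m.Coprime n → (ordCompl[2] m).Coprime (ordCompl[2] n) := fun hmn =>
    Nat.Coprime.coprime_dvd_left (Nat.ordCompl_dvd _ 2) (hmn.coprime_dvd_right (Nat.ordCompl_dvd _ 2))
  obtain ⟨⟨u, hu⟩, ⟨v, hv⟩, ⟨w, hw⟩⟩ := exists_eq_pow_three_of_coprime (hd hab) (hd hac) (hd hbc) h
  have hu0 : u ≠ 0 := by
    rintro rfl
    rw [zero_pow (by norm_num)] at hu
    exact (Nat.ordCompl_pos 2 ha.ne').ne' hu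
  have hv0 : v ≠ 0 := by
    rintro rfl
    rw [zero_pow (by norm_num)] at hv
    exact (Nat.ordCompl_pos 2 hb.ne').ne' hv
  have hw0 : w ≠ 0 := by
    rintro rfl
    rw [zero_pow (by norm_num)] at hw
    exact (Nat.ordCompl_pos 2 (by omega : a + b ≠ 0)).ne' hw
  -- the decompositions `n = 2^{v₂(n)} · (odd part)`
  have da := Nat.ordProj_mul_ordCompl_eq_self a 2
  have db := Nat.ordProj_mul_ordCompl_eq_self b 2
  have dc := Nat.ordProj_mul_ordCompl_eq_self (a + b) 2
  rw [hu] at da; rw [hv] at db; rw [hw] at dc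
  rcases Nat.even_or_odd a with hae | hao
  · -- `a` even: `b`, `c` odd, `w⁴ − v⁴ = 2^e u⁴`
    exfalso
    have hbo : Odd b := by
      by_contra hbe
      rw [Nat.not_odd_iff_even] at hbe
      exact Nat.not_coprime_of_dvd_of_dvd (by norm_num : 1 < 2) hae.two_dvd hbe.two_dvd hab
    have hco : Odd (a + b) := hae.add_odd hbo
    have hb' : b = v ^ 4 := by rw [← ordCompl_two_eq_self_of_odd hbo, hv]
    have hc' : a + b = w ^ 4 := by rw [← ordCompl_two_eq_self_of_odd hco, hw]
    have hZ : (w : ℤ) ^ 4 - v ^ 4 = 2 ^ a.factorization 2 * u ^ 4 := by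
      have e1 : ((a + b : ℕ) : ℤ) = (w : ℤ) ^ 4 := by exact_mod_cast hc'
      have e2 : ((2 ^ a.factorization 2 * u ^ 4 : ℕ) : ℤ) = (a : ℤ) := by exact_mod_cast da
      push_cast at e1 e2
      have e3 : (b : ℤ) = (v : ℤ) ^ 4 := by exact_mod_cast hb'
      linear_combination -e1 - e2 + e3
    exact false_of_pow_four_sub_eq_two_pow_mul (by exact_mod_cast hu0) (by exact_mod_cast hv0)
      (by exact_mod_cast hw0) hZ
  · rcases Nat.even_or_odd b with hbe | hbo
    · -- `b` even: `a`, `c` odd, `w⁴ − u⁴ = 2^e v⁴`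
      exfalso
      have hco : Odd (a + b) := hao.add_even hbe
      have ha' : a = u ^ 4 := by rw [← ordCompl_two_eq_self_of_odd hao, hu]
      have hc' : a + b = w ^ 4 := by rw [← ordCompl_two_eq_self_of_odd hco, hw]
      have hZ : (w : ℤ) ^ 4 - u ^ 4 = 2 ^ b.factorization 2 * v ^ 4 := by
        have e1 : ((a + b : ℕ) : ℤ) = (w : ℤ) ^ 4 := by exact_mod_cast hc'
        have e2 : ((2 ^ b.factorization 2 * v ^ 4 : ℕ) : ℤ) = (b : ℤ) := by exact_mod_cast db
        push_cast at e1 e2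
        have e3 : (a : ℤ) = (u : ℤ) ^ 4 := by exact_mod_cast ha'
        linear_combination -e1 - e2 + e3
      exact false_of_pow_four_sub_eq_two_pow_mul (by exact_mod_cast hv0) (by exact_mod_cast hu0)
        (by exact_mod_cast hw0) hZ
    · -- `a`, `b` odd, `c` even: `u⁴ + v⁴ = 2^e w⁴`, so `u⁴ = v⁴` and `a = b = 1`
      have ha' : a = u ^ 4 := by rw [← ordCompl_two_eq_self_of_odd hao, hu]
      have hb' : b = v ^ 4 := by rw [← ordCompl_two_eq_self_of_odd hbo, hv]
      have hZ : (u : ℤ) ^ 4 + v ^ 4 = 2 ^ (a + b).factorization 2 * w ^ 4 := by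
        have e2 : ((2 ^ (a + b).factorization 2 * w ^ 4 : ℕ) : ℤ) = ((a + b : ℕ) : ℤ) := by
          exact_mod_cast dc
        push_cast at e2
        have e3 : (a : ℤ) = (u : ℤ) ^ 4 := by exact_mod_cast ha'
        have e4 : (b : ℤ) = (v : ℤ) ^ 4 := by exact_mod_cast hb'
        linear_combination -e2 - e3 - e4
      have h44 := pow_four_eq_of_add_eq_two_pow_mul (by exact_mod_cast hu0) (by exact_mod_cast hv0)
        (by exact_mod_cast hw0) hZ
      have huv : u ^ 4 = v ^ 4 := by exact_mod_cast h44
      have hab' : a = b := by rw [ha', hb', huv]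
      subst hab'
      have : a = 1 := by simpa using hab
      exact ⟨this, this⟩

/-! ## III. Frey–Hellegouarch curves: the odd part of `|Δ_min|` is not an `8`-th power -/

/-- **`v_q(Δ_min(E_{A,B})) = 2 v_q(AB(A+B))` at every odd prime `q`** for the Frey curve
`E : y² = x(x − A)(x + B)`, `A, B` coprime, `AB(A+B) ≠ 0` (Serre 1987, (4.1.9): "`v_l(Δ) = 2 v_l(ABC)`
si `l ≠ 2`"; Pasten §6.5 p. 23: "`Δ_E = 2^s (abc)²`"), in the factorisation idiom of Thm. 6.17
(`c_q(E) = v_q(Δ_E)` = `(|Δ_min|).factorization q`): the tree's `ordMinimalDiscriminant_freyCurve_of_ne_two`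
read through `WeierstrassCurve.factorization_minimalDiscriminantNorm_holds` at the place above `q`.
[cite: Serre1987, §4.1 (4.1.9)] [cite: PastenShimura2024, Lemma 6.12 p. 23 (proof: Δ_E = 2^s (abc)²)] -/
theorem factorization_minimalDiscriminantNorm_freyCurve_of_ne_two {a b : ℤ} (hab : IsCoprime a b)
    (h0 : a * b * (a + b) ≠ 0) {q : ℕ} (hq : q.Prime) (hq2 : q ≠ 2) :
    ((freyCurve a b).minimalDiscriminantNorm ℤ).factorization q =
      2 * padicValNat q (a * b * (a + b)).natAbs := by
  set v : IsDedekindDomain.HeightOneSpectrum ℤ :=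
    (Rat.HeightOneSpectrum.primesEquiv (R := ℤ)).symm ⟨q, hq⟩ with hv_def
  have hv : Rat.HeightOneSpectrum.natGenerator v = q :=
    WeierstrassCurve.natGenerator_primesEquiv_symm q hq
  rw [← hv, WeierstrassCurve.factorization_minimalDiscriminantNorm_holds (freyCurve a b) v,
    ordMinimalDiscriminant_freyCurve_of_ne_two hab h0 v (hv ▸ hq2)]
  rfl



/-- **Lemma 6.10's rôle at `ℓ = 2` for Frey–Hellegouarch curves, PROVED: the odd part of
`|Δ_min(W)|` is not a perfect `8`-th power** when `W ≅ E_{a,b,c}` (`a, b > 0` coprime) has an odd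
prime of bad reduction. Pasten, proof of Thm. 6.17 (ii) p. 24, needs an odd `r ∣ N` with
`2³ ∤ c_r(E)` and obtains it from Lemma 6.10 (`S = {2}`, `L = 8`: Darmon–Granville and Faltings,
up to finitely many exceptional curves). Here instead: `v_r(Δ_min) = 2 v_r(abc)` at odd `r`
(`factorization_minimalDiscriminantNorm_freyCurve_of_ne_two`), so an `8`-th power odd part makes the
odd part of `abc` a fourth power (`exists_eq_mul_pow_of_dvd_factorization`), whence `a = b = 1`,
`c = 2` by Fermat's quartic theorems (`eq_one_of_ordCompl_two_mul_eq_pow_four`) — but then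
`v_q(Δ_min) = 2 v_q(2) = 0` at the given odd bad prime `q`, contradicting
`factorization_minimalDiscriminantNorm_pos_of_dvd`. No exceptional curve, no finiteness theorem.
[cite: PastenShimura2024, Thm. 6.17 p. 24 (proof, case (ii), ℓ = 2) with Lemma 6.10 p. 23] -/
theorem IsFreyHellegouarch.ordCompl_two_minimalDiscriminantNorm_ne_pow_eight
    {W : WeierstrassCurve ℚ} [W.IsElliptic] (hW : IsFreyHellegouarch W)
    (hodd : ∃ q : ℕ, q.Prime ∧ q ≠ 2 ∧ q ∣ W.conductorNorm ℤ) (k : ℕ) :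
    ordCompl[2] (W.minimalDiscriminantNorm ℤ) ≠ k ^ 8 := by
  obtain ⟨a, b, C, ha, hb, hcop, hCW⟩ := hW
  obtain ⟨q, hq, hq2, hqN⟩ := hodd
  intro hk
  have habZ : IsCoprime (a : ℤ) (b : ℤ) := Nat.isCoprime_iff_coprime.mpr hcop
  have h0 : (a : ℤ) * b * (a + b) ≠ 0 := by positivity
  have hΔ : W.minimalDiscriminantNorm ℤ = (freyCurve (a : ℤ) b).minimalDiscriminantNorm ℤ := by
    rw [← WeierstrassCurve.minimalDiscriminantNorm_smul_rat W C, hCW]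
  have hnat : ((a : ℤ) * b * (a + b)).natAbs = a * b * (a + b) := by
    have : ((a : ℤ) * b * (a + b)) = ((a * b * (a + b) : ℕ) : ℤ) := by push_cast; ring
    rw [this, Int.natAbs_natCast]
  -- every odd prime exponent of `abc` is divisible by `4`
  have hfac : ∀ p : ℕ, p.Prime → p ≠ 2 →
      (W.minimalDiscriminantNorm ℤ).factorization p = 2 * (a * b * (a + b)).factorization p := by
    intro p hp hp2
    rw [hΔ, factorization_minimalDiscriminantNorm_freyCurve_of_ne_two habZ h0 hp hp2, hnat,
      Nat.factorization_def _ hp]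
  have hn0 : ordCompl[2] (a * b * (a + b)) ≠ 0 := (Nat.ordCompl_pos 2 (by positivity)).ne'
  have h4 : ∀ p : ℕ, p.Prime → p ∉ (∅ : Finset ℕ) →
      4 ∣ (ordCompl[2] (a * b * (a + b))).factorization p := by
    intro p hp _
    rw [Nat.factorization_ordCompl]
    by_cases hp2 : p = 2
    · subst hp2; simp
    rw [Finsupp.erase_ne hp2]
    have e1 : (ordCompl[2] (W.minimalDiscriminantNorm ℤ)).factorization p =
        (W.minimalDiscriminantNorm ℤ).factorization p := by
      rw [Nat.factorization_ordCompl, Finsupp.erase_ne hp2]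
    have e3 : (k ^ 8).factorization p = 8 * k.factorization p := by
      rw [Nat.factorization_pow]; simp
    have : 2 * (a * b * (a + b)).factorization p = 8 * k.factorization p := by
      rw [← hfac p hp hp2, ← e1, hk, e3]
    exact ⟨k.factorization p, by omega⟩
  obtain ⟨m, t, -, hmS, hmt⟩ := exists_eq_mul_pow_of_dvd_factorization ∅ hn0 h4
  have hm1 : m = 1 := Nat.eq_one_iff_not_exists_prime_dvd.mpr fun p hp hpm =>
    Finset.notMem_empty p (hmS p hp hpm)
  rw [hm1, one_mul] at hmt
  obtain ⟨rfl, rfl⟩ := eq_one_of_ordCompl_two_mul_eq_pow_four ha hb hcop hmt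
  -- now `abc = 2`: no odd prime divides `N`
  have hpos := factorization_minimalDiscriminantNorm_pos_of_dvd W hq hqN
  rw [hfac q hq hq2] at hpos
  have h2 : (1 * 1 * (1 + 1) : ℕ) = 2 := by norm_num
  rw [h2, Nat.Prime.factorization Nat.prime_two, Finsupp.single_apply, if_neg (Ne.symm hq2)] at hpos
  omega


/-! ## IV. Lemma 6.12 for `ℓ ≥ 5` from Wiles, Ribet 1997 and Darmon–Merel 1997 -/

/-- `2^e X^ℓ = 2^{e mod ℓ} (2^{⌊e/ℓ⌋} X)^ℓ` in `ℤ` (the normalisation "`0 ≤ m < ℓ`" of Lemma 6.12's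
proof). [folklore] -/
private theorem two_pow_mul_pow_eq_mod (e ℓ : ℕ) (X : ℤ) :
    (2 : ℤ) ^ e * X ^ ℓ = 2 ^ (e % ℓ) * (2 ^ (e / ℓ) * X) ^ ℓ := by
  rw [mul_pow, ← pow_mul, ← mul_assoc, ← pow_add, Nat.mod_add_div']


/-- **The trichotomy of Lemma 6.12's proof** for a solution of `x^ℓ + 2^m y^ℓ + z^ℓ = 0`
(`ℓ ≥ 5` prime, `m < ℓ`, pairwise coprime, `xyz ≠ 0`): `m = 0` is excluded by Fermat's Last
Theorem for `ℓ` (Wiles), `2 ≤ m < ℓ` by Ribet 1997, and `m = 1` forces `(x,y,z) = ±(1,−1,1)`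
(Darmon–Merel). [cite: PastenShimura2024, Lemma 6.12 p. 23 (proof)] -/
theorem eq_one_and_trivial_of_fermatTwoPower (hRib : ribet1997_twoPowerFermat)
    (hDM : darmonMerel1997_denesEquation) {ℓ : ℕ} (hℓ : ℓ.Prime) (h5 : 5 ≤ ℓ)
    (hFLT : FermatLastTheoremFor ℓ) {x y z : ℤ} {m : ℕ} (hm : m < ℓ) (hx : x ≠ 0) (hy : y ≠ 0)
    (hz : z ≠ 0) (hxy : IsCoprime x y) (hxz : IsCoprime x z) (hyz : IsCoprime y z)
    (h : x ^ ℓ + 2 ^ m * y ^ ℓ + z ^ ℓ = 0) :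
    m = 1 ∧ ((x = 1 ∧ y = -1 ∧ z = 1) ∨ (x = -1 ∧ y = 1 ∧ z = -1)) := by
  have hodd : Odd ℓ := hℓ.odd_of_ne_two (by omega)
  rcases Nat.lt_or_ge m 2 with hm2 | hm2
  · interval_cases m
    · -- `m = 0`: Fermat
      exfalso
      refine (fermatLastTheoremFor_iff_int.mp hFLT) x y (-z) hx hy (neg_ne_zero.mpr hz) ?_
      rw [hodd.neg_pow]
      linear_combination h
    · exact ⟨rfl, hDM ℓ hℓ h5 x y z (mul_ne_zero (mul_ne_zero hx hy) hz) hxy hxz hyz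
        (by simpa using h)⟩
  · exact absurd h (hRib ℓ hℓ h5 m hm2 hm x y z (mul_ne_zero (mul_ne_zero hx hy) hz) hxy hxz hyz)


/-- **Lemma 6.12 in `abc`-form for `ℓ ≥ 5`.** For coprime positive `a + b = c` whose odd part of
`abc` is a perfect `ℓ`-th power (`ℓ ≥ 5` prime), `(a, b, c) = (1, 1, 2)` — granted Fermat's Last
Theorem for `ℓ`, Ribet 1997 and Darmon–Merel 1997 (proof of Lemma 6.12: "the odd parts of them are
perfect `ℓ`-th powers. Exactly one of `a,b,c` is even, so the equation `a+b=c` yields a solution of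
`x^ℓ + 2^m y^ℓ + z^ℓ = 0` … `0 ≤ m < ℓ`"). [cite: PastenShimura2024, Lemma 6.12 p. 23 (proof)] -/
theorem eq_one_of_ordCompl_two_mul_eq_pow_prime (hRib : ribet1997_twoPowerFermat)
    (hDM : darmonMerel1997_denesEquation) {ℓ : ℕ} (hℓ : ℓ.Prime) (h5 : 5 ≤ ℓ)
    (hFLT : FermatLastTheoremFor ℓ) {a b t : ℕ} (ha : 0 < a) (hb : 0 < b) (hab : a.Coprime b)
    (h : ordCompl[2] (a * b * (a + b)) = t ^ ℓ) : a = 1 ∧ b = 1 := by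
  have hℓ0 : ℓ ≠ 0 := hℓ.ne_zero
  have hodd : Odd ℓ := hℓ.odd_of_ne_two (by omega)
  have hac : a.Coprime (a + b) := Nat.coprime_self_add_right.mpr hab
  have hbc : b.Coprime (a + b) := Nat.coprime_add_self_right.mpr hab.symm
  rw [Nat.ordCompl_mul, Nat.ordCompl_mul] at h
  have hd : ∀ {m n : ℕ}, m.Coprime n → (ordCompl[2] m).Coprime (ordCompl[2] n) := fun hmn =>
    Nat.Coprime.coprime_dvd_left (Nat.ordCompl_dvd _ 2) (hmn.coprime_dvd_right (Nat.ordCompl_dvd _ 2))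
  obtain ⟨⟨u, hu⟩, ⟨v, hv⟩, ⟨w, hw⟩⟩ := exists_eq_pow_three_of_coprime (hd hab) (hd hac) (hd hbc) h
  have hu0 : u ≠ 0 := by
    rintro rfl
    rw [zero_pow hℓ0] at hu
    exact (Nat.ordCompl_pos 2 ha.ne').ne' hu
  have hv0 : v ≠ 0 := by
    rintro rfl
    rw [zero_pow hℓ0] at hv
    exact (Nat.ordCompl_pos 2 hb.ne').ne' hv
  have hw0 : w ≠ 0 := by
    rintro rfl
    rw [zero_pow hℓ0] at hw
    exact (Nat.ordCompl_pos 2 (by omega : a + b ≠ 0)).ne' hw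
  -- the roots divide the members
  have hroot : ∀ {n X : ℕ}, ordCompl[2] n = X ^ ℓ → X ∣ n := fun {n X} hn =>
    ((dvd_pow_self X hℓ0).trans (dvd_of_eq hn.symm)).trans (Nat.ordCompl_dvd n 2)
  have hua : u ∣ a := hroot hu
  have hvb : v ∣ b := hroot hv
  have hwc : w ∣ a + b := hroot hw
  -- decompositions `n = 2^{v₂(n)} · (odd part)`
  have da := Nat.ordProj_mul_ordCompl_eq_self a 2
  have db := Nat.ordProj_mul_ordCompl_eq_self b 2
  have dc := Nat.ordProj_mul_ordCompl_eq_self (a + b) 2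
  rw [hu] at da; rw [hv] at db; rw [hw] at dc
  -- generic facts about the even member `n = 2^e X^ℓ`, `Y = 2^(e/ℓ) X`
  have hY : ∀ {n X : ℕ}, 2 ^ n.factorization 2 * X ^ ℓ = n →
      2 ^ (n.factorization 2 / ℓ) * X ∣ n := by
    intro n X hn
    have h1 : 2 ^ (n.factorization 2 / ℓ) ∣ 2 ^ n.factorization 2 :=
      pow_dvd_pow 2 (Nat.div_le_self _ _)
    exact (mul_dvd_mul h1 (dvd_pow_self X hℓ0)).trans (dvd_of_eq hn)
  rcases Nat.even_or_odd a with hae | hao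
  · -- `a` even, `b` and `c` odd: `v^ℓ + 2^m (2^f u)^ℓ + (−w)^ℓ = 0`
    exfalso
    have hbo : Odd b := by
      by_contra hbe
      rw [Nat.not_odd_iff_even] at hbe
      exact Nat.not_coprime_of_dvd_of_dvd (by norm_num : 1 < 2) hae.two_dvd hbe.two_dvd hab
    have hco : Odd (a + b) := hae.add_odd hbo
    have hb' : b = v ^ ℓ := by rw [← ordCompl_two_eq_self_of_odd hbo, hv]
    have hc' : a + b = w ^ ℓ := by rw [← ordCompl_two_eq_self_of_odd hco, hw]
    set e := a.factorization 2 with he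
    have hYa : 2 ^ (e / ℓ) * u ∣ a := hY da
    have hZ : (v : ℤ) ^ ℓ + 2 ^ (e % ℓ) * ((2 : ℤ) ^ (e / ℓ) * u) ^ ℓ + (-(w : ℤ)) ^ ℓ = 0 := by
      rw [hodd.neg_pow, ← two_pow_mul_pow_eq_mod]
      have e1 : ((a + b : ℕ) : ℤ) = (w : ℤ) ^ ℓ := by exact_mod_cast hc'
      have e2 : ((2 ^ e * u ^ ℓ : ℕ) : ℤ) = (a : ℤ) := by exact_mod_cast da
      have e3 : (b : ℤ) = (v : ℤ) ^ ℓ := by exact_mod_cast hb'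
      push_cast at e1 e2
      linear_combination e2 + e1 - e3
    have hcop : IsCoprime (v : ℤ) ((2 : ℤ) ^ (e / ℓ) * u) ∧ IsCoprime (v : ℤ) (-(w : ℤ)) ∧
        IsCoprime ((2 : ℤ) ^ (e / ℓ) * u) (-(w : ℤ)) := by
      refine ⟨?_, ?_, ?_⟩
      · have : Nat.Coprime v (2 ^ (e / ℓ) * u) :=
          Nat.Coprime.coprime_dvd_left hvb (hab.symm.coprime_dvd_right hYa)
        exact_mod_cast Nat.isCoprime_iff_coprime.mpr this
      · have : Nat.Coprime v w := Nat.Coprime.coprime_dvd_left hvb (hbc.coprime_dvd_right hwc)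
        exact (Nat.isCoprime_iff_coprime.mpr this).neg_right
      · have : Nat.Coprime (2 ^ (e / ℓ) * u) w :=
          Nat.Coprime.coprime_dvd_left hYa (hac.coprime_dvd_right hwc)
        have h' : IsCoprime ((2 ^ (e / ℓ) * u : ℕ) : ℤ) (w : ℤ) := Nat.isCoprime_iff_coprime.mpr this
        push_cast at h'
        exact h'.neg_right
    obtain ⟨-, htriv⟩ := eq_one_and_trivial_of_fermatTwoPower hRib hDM hℓ h5 hFLT
      (Nat.mod_lt e hℓ.pos) (by exact_mod_cast hv0) (by positivity)
      (neg_ne_zero.mpr (by exact_mod_cast hw0)) hcop.1 hcop.2.1 hcop.2.2 hZ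
    -- `|v| = |w| = 1` forces `b = c = 1`, absurd since `c = a + b > b`
    have hv1 : (v : ℤ) = 1 ∨ (v : ℤ) = -1 := by
      rcases htriv with ⟨h1, -, -⟩ | ⟨h1, -, -⟩ <;> simp [h1]
    have hw1 : (w : ℤ) = 1 ∨ (w : ℤ) = -1 := by
      rcases htriv with ⟨-, -, h1⟩ | ⟨-, -, h1⟩
      · right; linear_combination -h1
      · left; linear_combination -h1
    have hv1' : v = 1 := by rcases hv1 with h1 | h1 <;> [exact_mod_cast h1; omega]
    have hw1' : w = 1 := by rcases hw1 with h1 | h1 <;> [exact_mod_cast h1; omega]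
    rw [hv1', one_pow] at hb'
    rw [hw1', one_pow] at hc'
    omega
  · rcases Nat.even_or_odd b with hbe | hbo
    · -- `b` even, `a` and `c` odd: `u^ℓ + 2^m (2^f v)^ℓ + (−w)^ℓ = 0`
      exfalso
      have hco : Odd (a + b) := hao.add_even hbe
      have ha' : a = u ^ ℓ := by rw [← ordCompl_two_eq_self_of_odd hao, hu]
      have hc' : a + b = w ^ ℓ := by rw [← ordCompl_two_eq_self_of_odd hco, hw]
      set e := b.factorization 2 with he
      have hYb : 2 ^ (e / ℓ) * v ∣ b := hY db
      have hZ : (u : ℤ) ^ ℓ + 2 ^ (e % ℓ) * ((2 : ℤ) ^ (e / ℓ) * v) ^ ℓ + (-(w : ℤ)) ^ ℓ = 0 := by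
        rw [hodd.neg_pow, ← two_pow_mul_pow_eq_mod]
        have e1 : ((a + b : ℕ) : ℤ) = (w : ℤ) ^ ℓ := by exact_mod_cast hc'
        have e2 : ((2 ^ e * v ^ ℓ : ℕ) : ℤ) = (b : ℤ) := by exact_mod_cast db
        have e3 : (a : ℤ) = (u : ℤ) ^ ℓ := by exact_mod_cast ha'
        push_cast at e1 e2
        linear_combination e2 + e1 - e3
      have hcop : IsCoprime (u : ℤ) ((2 : ℤ) ^ (e / ℓ) * v) ∧ IsCoprime (u : ℤ) (-(w : ℤ)) ∧
          IsCoprime ((2 : ℤ) ^ (e / ℓ) * v) (-(w : ℤ)) := by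
        refine ⟨?_, ?_, ?_⟩
        · have : Nat.Coprime u (2 ^ (e / ℓ) * v) :=
            Nat.Coprime.coprime_dvd_left hua (hab.coprime_dvd_right hYb)
          exact_mod_cast Nat.isCoprime_iff_coprime.mpr this
        · have : Nat.Coprime u w := Nat.Coprime.coprime_dvd_left hua (hac.coprime_dvd_right hwc)
          exact (Nat.isCoprime_iff_coprime.mpr this).neg_right
        · have : Nat.Coprime (2 ^ (e / ℓ) * v) w :=
            Nat.Coprime.coprime_dvd_left hYb (hbc.coprime_dvd_right hwc)
          have h' : IsCoprime ((2 ^ (e / ℓ) * v : ℕ) : ℤ) (w : ℤ) :=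
            Nat.isCoprime_iff_coprime.mpr this
          push_cast at h'
          exact h'.neg_right
      obtain ⟨-, htriv⟩ := eq_one_and_trivial_of_fermatTwoPower hRib hDM hℓ h5 hFLT
        (Nat.mod_lt e hℓ.pos) (by exact_mod_cast hu0) (by positivity)
        (neg_ne_zero.mpr (by exact_mod_cast hw0)) hcop.1 hcop.2.1 hcop.2.2 hZ
      have hu1 : (u : ℤ) = 1 ∨ (u : ℤ) = -1 := by
        rcases htriv with ⟨h1, -, -⟩ | ⟨h1, -, -⟩ <;> simp [h1]
      have hw1 : (w : ℤ) = 1 ∨ (w : ℤ) = -1 := by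
        rcases htriv with ⟨-, -, h1⟩ | ⟨-, -, h1⟩
        · right; linear_combination -h1
        · left; linear_combination -h1
      have hu1' : u = 1 := by rcases hu1 with h1 | h1 <;> [exact_mod_cast h1; omega]
      have hw1' : w = 1 := by rcases hw1 with h1 | h1 <;> [exact_mod_cast h1; omega]
      rw [hu1', one_pow] at ha'
      rw [hw1', one_pow] at hc'
      omega
    · -- `a`, `b` odd, `c` even: `u^ℓ + 2^m (−2^f w)^ℓ + v^ℓ = 0`
      have ha' : a = u ^ ℓ := by rw [← ordCompl_two_eq_self_of_odd hao, hu]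
      have hb' : b = v ^ ℓ := by rw [← ordCompl_two_eq_self_of_odd hbo, hv]
      set e := (a + b).factorization 2 with he
      have hYc : 2 ^ (e / ℓ) * w ∣ a + b := hY dc
      have hZ : (u : ℤ) ^ ℓ + 2 ^ (e % ℓ) * (-((2 : ℤ) ^ (e / ℓ) * w)) ^ ℓ + (v : ℤ) ^ ℓ = 0 := by
        rw [hodd.neg_pow, mul_neg, ← two_pow_mul_pow_eq_mod]
        have e2 : ((2 ^ e * w ^ ℓ : ℕ) : ℤ) = ((a + b : ℕ) : ℤ) := by exact_mod_cast dc
        have e3 : (a : ℤ) = (u : ℤ) ^ ℓ := by exact_mod_cast ha'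
        have e4 : (b : ℤ) = (v : ℤ) ^ ℓ := by exact_mod_cast hb'
        push_cast at e2
        linear_combination -e2 - e3 - e4
      have hcop : IsCoprime (u : ℤ) (-((2 : ℤ) ^ (e / ℓ) * w)) ∧ IsCoprime (u : ℤ) (v : ℤ) ∧
          IsCoprime (-((2 : ℤ) ^ (e / ℓ) * w)) (v : ℤ) := by
        refine ⟨?_, ?_, ?_⟩
        · have : Nat.Coprime u (2 ^ (e / ℓ) * w) :=
            Nat.Coprime.coprime_dvd_left hua (hac.coprime_dvd_right hYc)
          have h' : IsCoprime (u : ℤ) ((2 ^ (e / ℓ) * w : ℕ) : ℤ) := Nat.isCoprime_iff_coprime.mpr this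
          push_cast at h'
          exact h'.neg_right
        · exact Nat.isCoprime_iff_coprime.mpr (Nat.Coprime.coprime_dvd_left hua
            (hab.coprime_dvd_right hvb))
        · have : Nat.Coprime (2 ^ (e / ℓ) * w) v :=
            Nat.Coprime.coprime_dvd_left hYc (hbc.symm.coprime_dvd_right hvb)
          have h' : IsCoprime ((2 ^ (e / ℓ) * w : ℕ) : ℤ) (v : ℤ) :=
            Nat.isCoprime_iff_coprime.mpr this
          push_cast at h'
          exact h'.neg_left
      obtain ⟨-, htriv⟩ := eq_one_and_trivial_of_fermatTwoPower hRib hDM hℓ h5 hFLT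
        (Nat.mod_lt e hℓ.pos) (by exact_mod_cast hu0) (neg_ne_zero.mpr (by positivity))
        (by exact_mod_cast hv0) hcop.1 hcop.2.1 hcop.2.2 hZ
      have hu1 : (u : ℤ) = 1 ∨ (u : ℤ) = -1 := by
        rcases htriv with ⟨h1, -, -⟩ | ⟨h1, -, -⟩ <;> simp [h1]
      have hv1 : (v : ℤ) = 1 ∨ (v : ℤ) = -1 := by
        rcases htriv with ⟨-, -, h1⟩ | ⟨-, -, h1⟩ <;> simp [h1]
      have hu1' : u = 1 := by rcases hu1 with h1 | h1 <;> [exact_mod_cast h1; omega]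
      have hv1' : v = 1 := by rcases hv1 with h1 | h1 <;> [exact_mod_cast h1; omega]
      rw [hu1', one_pow] at ha'
      rw [hv1', one_pow] at hb'
      exact ⟨ha', hb'⟩


/-- **Pasten 2024, Lemma 6.12 for `ℓ ≥ 5`, over the tree's named facts.** For a
Frey–Hellegouarch curve `W` (up to `ℚ`-isomorphism `E_{a,b,c}`, `a, b > 0` coprime) with an odd
prime of bad reduction (i.e. `(a,b,c) ≠ (1,1,2)`) and a prime `ℓ ≥ 5`, the odd part of
`|Δ_min(W)|` is not a perfect `ℓ`-th power — from Fermat's Last Theorem for `ℓ` (Mathlib's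
statement `FermatLastTheoremFor ℓ`, Wiles), Ribet 1997 (`ribet1997_twoPowerFermat`) and
Darmon–Merel 1997 (`darmonMerel1997_denesEquation`), exactly as printed: `v_r(Δ_min) = 2 v_r(abc)`
at odd `r` (Serre (4.1.9), tree `ordMinimalDiscriminant_freyCurve_of_ne_two`), so the odd parts of
`a, b, c` are `ℓ`-th powers and `a + b = c` is a solution of `x^ℓ + 2^m y^ℓ + z^ℓ = 0`,
`0 ≤ m < ℓ`; `m = 0` is Wiles, `1 < m < ℓ` Ribet's Thm. 3, `m = 1` Darmon–Merel (trivial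
solution, `abc = 2`). The case `ℓ = 3` of the printed lemma (Euler, `x³ + y³ = 2z³`; Legendre,
`x³ + y³ = 4z³`) is not covered by the tree's facts (`p ≥ 5`) and is not asserted here.
[cite: PastenShimura2024, Lemma 6.12 p. 23] [cite: Ribet1997, Thm. 3] [cite: DarmonMerel1997, Main Theorem (1)] -/
theorem IsFreyHellegouarch.ordCompl_two_minimalDiscriminantNorm_ne_pow_of_five_le
    (hRib : ribet1997_twoPowerFermat) (hDM : darmonMerel1997_denesEquation) {ℓ : ℕ}
    (hℓ : ℓ.Prime) (h5 : 5 ≤ ℓ) (hFLT : FermatLastTheoremFor ℓ)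
    {W : WeierstrassCurve ℚ} [W.IsElliptic] (hW : IsFreyHellegouarch W)
    (hodd : ∃ q : ℕ, q.Prime ∧ q ≠ 2 ∧ q ∣ W.conductorNorm ℤ) (k : ℕ) :
    ordCompl[2] (W.minimalDiscriminantNorm ℤ) ≠ k ^ ℓ := by
  obtain ⟨a, b, C, ha, hb, hcop, hCW⟩ := hW
  obtain ⟨q, hq, hq2, hqN⟩ := hodd
  intro hk
  have hℓ2 : Nat.Coprime ℓ 2 := (Nat.coprime_primes hℓ Nat.prime_two).mpr (by omega)
  have habZ : IsCoprime (a : ℤ) (b : ℤ) := Nat.isCoprime_iff_coprime.mpr hcop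
  have h0 : (a : ℤ) * b * (a + b) ≠ 0 := by positivity
  have hΔ : W.minimalDiscriminantNorm ℤ = (freyCurve (a : ℤ) b).minimalDiscriminantNorm ℤ := by
    rw [← WeierstrassCurve.minimalDiscriminantNorm_smul_rat W C, hCW]
  have hnat : ((a : ℤ) * b * (a + b)).natAbs = a * b * (a + b) := by
    have : ((a : ℤ) * b * (a + b)) = ((a * b * (a + b) : ℕ) : ℤ) := by push_cast; ring
    rw [this, Int.natAbs_natCast]
  have hfac : ∀ p : ℕ, p.Prime → p ≠ 2 →
      (W.minimalDiscriminantNorm ℤ).factorization p = 2 * (a * b * (a + b)).factorization p := by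
    intro p hp hp2
    rw [hΔ, factorization_minimalDiscriminantNorm_freyCurve_of_ne_two habZ h0 hp hp2, hnat,
      Nat.factorization_def _ hp]
  have hn0 : ordCompl[2] (a * b * (a + b)) ≠ 0 := (Nat.ordCompl_pos 2 (by positivity)).ne'
  have hdiv : ∀ p : ℕ, p.Prime → p ∉ (∅ : Finset ℕ) →
      ℓ ∣ (ordCompl[2] (a * b * (a + b))).factorization p := by
    intro p hp _
    rw [Nat.factorization_ordCompl]
    by_cases hp2 : p = 2
    · subst hp2; simp
    rw [Finsupp.erase_ne hp2]
    have e1 : (ordCompl[2] (W.minimalDiscriminantNorm ℤ)).factorization p =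
        (W.minimalDiscriminantNorm ℤ).factorization p := by
      rw [Nat.factorization_ordCompl, Finsupp.erase_ne hp2]
    have e3 : (k ^ ℓ).factorization p = ℓ * k.factorization p := by
      rw [Nat.factorization_pow]; simp
    have : 2 * (a * b * (a + b)).factorization p = ℓ * k.factorization p := by
      rw [← hfac p hp hp2, ← e1, hk, e3]
    exact hℓ2.dvd_of_dvd_mul_left ⟨k.factorization p, this⟩
  obtain ⟨m, t, -, hmS, hmt⟩ := exists_eq_mul_pow_of_dvd_factorization ∅ hn0 hdiv
  have hm1 : m = 1 := Nat.eq_one_iff_not_exists_prime_dvd.mpr fun p hp hpm =>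
    Finset.notMem_empty p (hmS p hp hpm)
  rw [hm1, one_mul] at hmt
  obtain ⟨rfl, rfl⟩ := eq_one_of_ordCompl_two_mul_eq_pow_prime hRib hDM hℓ h5 hFLT ha hb hcop hmt
  have hpos := factorization_minimalDiscriminantNorm_pos_of_dvd W hq hqN
  rw [hfac q hq hq2] at hpos
  have h2 : (1 * 1 * (1 + 1) : ℕ) = 2 := by norm_num
  rw [h2, Nat.Prime.factorization Nat.prime_two, Finsupp.single_apply, if_neg (Ne.symm hq2)] at hpos
  omega


/-! ## V. Assembly: Thm. 6.1 (b) without Lemma 6.10, and over declarations only (but `ℓ = 3`) -/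

/-- **Pasten 2024, Thm. 6.1 (b) from the Ribet–Takahashi inputs and `mestreOesterle1989_thm_1`,
WITHOUT Lemma 6.10.** Verbatim the tree's `PastenShimura2024_thm_6_1_b_of_ribetTakahashi_mestreOesterle`
(`ShimuraCurveRibetTakahashiCokernelProofs.lean`: the witness form of Thm. 6.17 fed, prime by prime,
in class (b.1) by Mestre–Oesterlé's Thm. 1 and in class (b.2) by Lemma 6.12 `h612` for `ℓ ≥ 3`) with
its hypothesis `h610` (Lemma 6.10 at `S ∋ 2`, `L = 8`, Darmon–Granville) DELETED: at `ℓ = 2` in class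
(b.2) the witness — an odd multiplicative `r ∣ N` with `2³ ∤ c_r(E)` — now comes from
`IsFreyHellegouarch.ordCompl_two_minimalDiscriminantNorm_ne_pow_eight` through
`fermatInput_of_isFreyHellegouarch` at the exponent `8`, so the exceptional family of
`PastenShimura2024_thm_6_17_of_witnesses` is empty at every prime. Inputs: the component-group data
`cI cJ` with `h613` (Prop. 6.13), `hJc`, `h68` (Lemma 6.8), `h614` (Lemma 6.14 at `S`, constant `κ₁`),
`hMO`, the Jacquet–Langlands fact `hP`, the `D = 1` bridge `h0`, and `h612`.
[cite: PastenShimura2024, Thm. 6.1 (b) p. 20, Thm. 6.17 p. 24 (proof, cases (i)/(ii)), Lemmas 6.10–6.12 p. 23, §6.9 p. 25] [cite: MestreOesterle1989, §4 Théorème 1 (p. 176)] -/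
theorem PastenShimura2024_thm_6_1_b_of_ribetTakahashi_mestreOesterle_fermatQuartic
    (cI cJ : ∀ {D M : ℕ} {X : ShimuraCurveData D M} {W' : WeierstrassCurve ℚ},
      ShimuraParametrizationData X W' → ℕ → ℕ)
    (hI : ∀ {D M : ℕ} {X : ShimuraCurveData D M} {W' : WeierstrassCurve ℚ}
      (P : ShimuraParametrizationData X W') (p : ℕ), 0 < cI P p)
    (hJ : ∀ {D M : ℕ} {X : ShimuraCurveData D M} {W' : WeierstrassCurve ℚ}
      (P : ShimuraParametrizationData X W') (p : ℕ), 0 < cJ P p)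
    (h613 : ∀ {N d M₁ D M p r : ℕ}, p.Prime → r.Prime → p ≠ r → D = d * (p * r) →
      M₁ = p * r * M → IsAdmissibleFactorization N D M →
      ∀ (X₁ : ShimuraCurveData d M₁) (X₂ : ShimuraCurveData D M)
        (W : WeierstrassCurve ℚ) [W.IsElliptic] [W.IsGloballyMinimal], W.conductorNorm ℤ = N →
      ∀ (W₁' : WeierstrassCurve ℚ) [W₁'.IsElliptic] (P₁ : ShimuraParametrizationData X₁ W₁'),
        P₁.IsMinimalFor W →
      ∀ (W₂' : WeierstrassCurve ℚ) [W₂'.IsElliptic] (P₂ : ShimuraParametrizationData X₂ W₂'),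
        P₂.IsMinimalFor W →
        P₁.deg * (cI P₁ p ^ 2 * cJ P₂ r ^ 2) =
          P₂.deg * ((W₁'.minimalDiscriminantNorm ℤ).factorization p *
            (W₂'.minimalDiscriminantNorm ℤ).factorization r))
    (hJc : ∀ {N D M : ℕ}, IsAdmissibleFactorization N D M →
      ∀ (X : ShimuraCurveData D M) (W : WeierstrassCurve ℚ) [W.IsElliptic] [W.IsGloballyMinimal],
        W.conductorNorm ℤ = N →
      ∀ (W' : WeierstrassCurve ℚ) [W'.IsElliptic] (P : ShimuraParametrizationData X W'),
        P.IsMinimalFor W → ∀ p : ℕ, p.Prime → p ∣ D →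
        cJ P p ∣ (W'.minimalDiscriminantNorm ℤ).factorization p)
    (h68 : ∀ (W W' : WeierstrassCurve ℚ) [W.IsElliptic] [W'.IsElliptic], W.IsIsogenous W' →
      ∀ p : ℕ, p.Prime → p ∣ W.conductorNorm ℤ → ¬ p ^ 2 ∣ W.conductorNorm ℤ →
        ∃ a b : ℕ, 0 < a ∧ a ≤ 163 ∧ 0 < b ∧ b ≤ 163 ∧
          (W'.minimalDiscriminantNorm ℤ).factorization p * b =
            a * (W.minimalDiscriminantNorm ℤ).factorization p)
    {S : Finset ℕ} {κ₁ : ℕ} (hκ₁ : 0 < κ₁)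
    (h614 : ∀ {N D M : ℕ}, IsAdmissibleFactorization N D M →
      ∀ (X : ShimuraCurveData D M) (W : WeierstrassCurve ℚ) [W.IsElliptic] [W.IsGloballyMinimal],
        W.conductorNorm ℤ = N → (∀ q : ℕ, q.Prime → q ∉ S → ¬ q ^ 2 ∣ N) →
      ∀ (W' : WeierstrassCurve ℚ) [W'.IsElliptic] (P : ShimuraParametrizationData X W'),
        P.IsMinimalFor W → ∀ p : ℕ, p.Prime → p ∣ M → ¬ p ^ 2 ∣ M → cI P p ∣ κ₁)
    (hMO : mestreOesterle1989_thm_1) (hP : nonempty_shimuraParametrizationData)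
    (h0 : ∀ {N : ℕ} [NeZero N] (X : ShimuraCurveData 1 N) (W : WeierstrassCurve ℚ) [W.IsElliptic]
      [W.IsGloballyMinimal], W.conductorNorm ℤ = N →
      (W.IsSemistable ℤ ∧ ¬ N.Prime) ∨
        (IsFreyHellegouarch W ∧ 2 ≤ (N.primeFactors.erase 2).card) →
      ∀ (W₁ : WeierstrassCurve ℚ) [W₁.IsElliptic] (D₁ : ModularParametrizationData W₁ N),
        IsNewformOf W D₁.f →
        (∀ (W₂ : WeierstrassCurve ℚ) [W₂.IsElliptic] (D₂ : ModularParametrizationData W₂ N),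
            D₂.f = D₁.f → D₁.modularDegree ≤ D₂.modularDegree) →
      ∀ (W' : WeierstrassCurve ℚ) [W'.IsElliptic] (P : ShimuraParametrizationData X W'),
        P.IsMinimalFor W → P.deg ∣ D₁.modularDegree)
    (hκ₁' : ∀ q ∈ κ₁.primeFactors, q ≤ 163) (h2S : 2 ∈ S)
    (h612 : ∀ (W : WeierstrassCurve ℚ) [W.IsElliptic], IsFreyHellegouarch W →
      (∃ q : ℕ, q.Prime ∧ q ≠ 2 ∧ q ∣ W.conductorNorm ℤ) →
      ∀ ℓ : ℕ, ℓ.Prime → 3 ≤ ℓ → ∀ k : ℕ, ordCompl[2] (W.minimalDiscriminantNorm ℤ) ≠ k ^ ℓ) :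
    PastenShimura2024_thm_6_1_b := by
  classical
  -- no exceptional family at all
  obtain ⟨κ₂, hκ₂, hκ₂', h617⟩ := PastenShimura2024_thm_6_17_of_witnesses cI cJ hI hJ h613 hJc h68
    hκ₁ h614 hP hκ₁' (fun _ => ∅)
  refine PastenShimura2024_thm_6_1_b_of_prop_6_13_bounded_of_lemma_6_8
    nonempty_shimuraCurveData_holds hP h0 (Nat.one_le_iff_ne_zero.mpr hκ₁.ne') hκ₂ hκ₁' hκ₂' ?_ h68
  intro N D M d p r hp hr hpr hD hadm X₁ X₂ W _ _ hWN hcl W₁' _ P₁ hP₁ W₂' _ P₂ hP₂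
  -- both classes are semistable away from `S ∋ 2`
  have hS : ∀ q : ℕ, q.Prime → q ∉ S → ¬ q ^ 2 ∣ N := by
    intro q hq hqS
    have hq2 : q ≠ 2 := fun h => hqS (h ▸ h2S)
    rw [← hWN]
    rcases hcl with ⟨hss, -⟩ | ⟨hFH, -⟩
    · exact not_sq_dvd_conductorNorm_of_isSemistable W hss hq
    · exact not_sq_dvd_conductorNorm_of_isFreyHellegouarch hFH hq hq2
  -- `i_p(d,prM) ∣ κ_S` (Lemma 6.14 at the admissible level `(d, prM)`, `p ∥ prM`)
  have hpD : p ∣ D := ⟨d * r, by rw [hD]; ring⟩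
  have hrD : r ∣ D := ⟨d * p, by rw [hD]; ring⟩
  obtain ⟨-, hadm₁, -, -⟩ := hadm.erase_two_primes hp hr hpr hpD hrD
  have hd : D / (p * r) = d := by rw [hD, Nat.mul_div_cancel _ (Nat.mul_pos hp.pos hr.pos)]
  rw [hd] at hadm₁
  obtain ⟨-, hp1, hp2⟩ := hadm.not_sq_dvd_mul_of_dvd hp hr hpr hpD
  have hiκ : cI P₁ p ∣ κ₁ := h614 hadm₁ X₁ W hWN hS W₁' P₁ hP₁ p hp hp1 hp2
  have hN1 : N ≠ 1 := fun h1 =>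
    hp.one_lt.ne' (Nat.dvd_one.mp (h1 ▸ (hadm.dvd_and_not_sq_dvd hp hpD).1))
  have hN1' : W.conductorNorm ℤ ≠ 1 := hWN.symm ▸ hN1
  -- the witnesses, prime by prime, in the two classes
  have hW : ∀ ℓ : ℕ, ℓ.Prime →
      (∃ r : ℕ, r.Prime ∧ r ∣ N ∧ ¬ r ^ 2 ∣ N ∧
        ¬ ℓ ∣ (W.minimalDiscriminantNorm ℤ).factorization r) ∨
      (ℓ < 11 ∧ ((∃ r : ℕ, r.Prime ∧ r ∣ N ∧ ¬ r ^ 2 ∣ N ∧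
          ¬ ℓ ^ 3 ∣ (W.minimalDiscriminantNorm ℤ).factorization r) ∨
        W.minimalDiscriminantNorm ℤ ∈ ((fun _ => ∅ : ℕ → Finset ℕ) ℓ))) := by
    intro ℓ hℓ
    rcases hcl with ⟨hss, -⟩ | ⟨hFH, hM2⟩
    · -- (b.1): Mestre–Oesterlé, `|Δ_min| ≠ k^ℓ` (`ℓ ≥ 7`) and `|Δ_min| ≠ k^{ℓ³}` (`ℓ³ ≥ 8`)
      by_cases h7 : 7 ≤ ℓ
      · left
        rw [← hWN]
        exact fermatInput_of_isSemistable W hss hN1'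
          (fun k hk hΔ => absurd (hMO W hss ℓ k hk hΔ) (by omega))
      · right
        refine ⟨by omega, Or.inl ?_⟩
        rw [← hWN]
        have h8 : 8 ≤ ℓ ^ 3 :=
          calc 8 = 2 ^ 3 := by norm_num
            _ ≤ ℓ ^ 3 := Nat.pow_le_pow_left hℓ.two_le 3
        exact fermatInput_of_isSemistable W hss hN1'
          (fun k hk hΔ => absurd (hMO W hss (ℓ ^ 3) k hk hΔ) (by omega))
    · -- (b.2): Lemma 6.12 for `ℓ ≥ 3`; at `ℓ = 2` the quartic descent (no exceptional curve)
      have hodd : ∃ q : ℕ, q.Prime ∧ q ≠ 2 ∧ q ∣ W.conductorNorm ℤ := by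
        obtain ⟨q, hq⟩ : (M.primeFactors.erase 2).Nonempty := Finset.card_pos.mp (by omega)
        obtain ⟨hq2, hq⟩ := Finset.mem_erase.mp hq
        refine ⟨q, Nat.prime_of_mem_primeFactors hq, hq2, ?_⟩
        rw [hWN, ← hadm.mul_eq]
        exact Dvd.dvd.mul_left (Nat.dvd_of_mem_primeFactors hq) D
      by_cases h3 : 3 ≤ ℓ
      · left
        rw [← hWN]
        exact fermatInput_of_isFreyHellegouarch W hFH (h612 W hFH hodd ℓ hℓ h3)
      · have hℓ2 : ℓ = 2 := by have := hℓ.two_le; omega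
        subst hℓ2
        refine Or.inr ⟨by norm_num, Or.inl ?_⟩
        rw [← hWN]
        obtain ⟨r, hr, hrN, hr2, hr8⟩ := fermatInput_of_isFreyHellegouarch W hFH (ℓ := 8)
          (IsFreyHellegouarch.ordCompl_two_minimalDiscriminantNorm_ne_pow_eight hFH hodd)
        exact ⟨r, hr, hrN, hr2, by norm_num; exact hr8⟩
  -- the condition on `M`, in the two classes
  have hM1 : (M.primeFactors.filter fun t => ¬ t ^ 2 ∣ N).card ≠ 1 := by
    rcases hcl with ⟨hss, hMp⟩ | ⟨hFH, hM2⟩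
    · have hfilt : (M.primeFactors.filter fun t => ¬ t ^ 2 ∣ N) = M.primeFactors :=
        Finset.filter_true_of_mem fun t ht => by
          rw [← hWN]
          exact not_sq_dvd_conductorNorm_of_isSemistable W hss (Nat.prime_of_mem_primeFactors ht)
      rw [hfilt]
      intro h1
      obtain ⟨t, ht⟩ := Finset.card_eq_one.mp h1
      have hsqN : Squarefree N := hWN ▸ (W.isSemistable_iff_squarefree_conductorNorm).mp hss
      have hsqM : Squarefree M :=
        Squarefree.squarefree_of_dvd ⟨D, by rw [← hadm.mul_eq, mul_comm]⟩ hsqN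
      have hM : M = t := by
        rw [← Nat.prod_primeFactors_of_squarefree hsqM, ht, Finset.prod_singleton]
      have htp : t.Prime := Nat.prime_of_mem_primeFactors (ht ▸ Finset.mem_singleton_self t)
      exact hMp (hM ▸ htp)
    · have hsub : M.primeFactors.erase 2 ⊆ M.primeFactors.filter fun t => ¬ t ^ 2 ∣ N := by
        intro t ht
        obtain ⟨ht2, ht⟩ := Finset.mem_erase.mp ht
        refine Finset.mem_filter.mpr ⟨ht, ?_⟩
        rw [← hWN]
        exact not_sq_dvd_conductorNorm_of_isFreyHellegouarch hFH (Nat.prime_of_mem_primeFactors ht) ht2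
      have := Finset.card_le_card hsub
      omega
  exact ⟨cI P₁ p, cJ P₂ r, hI P₁ p, hJ P₂ r, hiκ, h617 hadm X₂ W hWN hS hW hM1 W₂' P₂ hP₂ r hr hrD,
    h613 hp hr hpr hD rfl hadm X₁ X₂ W hWN W₁' P₁ hP₁ W₂' P₂ hP₂⟩


/-- **Pasten 2024, Thm. 6.1 (b) over the tree's facts — the trust base after this file.** As
`PastenShimura2024_thm_6_1_b_of_ribetTakahashi_treeFacts'` (`ShimuraCurveRibetTakahashiLevelOneAssemblyProofs`),
but: (`h610`) Lemma 6.10 is NO LONGER an input (discharged at its only use, `ℓ = 2` in class (b.2), by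
`IsFreyHellegouarch.ordCompl_two_minimalDiscriminantNorm_ne_pow_eight`); and (`h612`) Lemma 6.12 is
taken, for `ℓ ≥ 5`, from DECLARATIONS — Mathlib's statement `FermatLastTheorem` (Wiles, Taylor–Wiles),
and the tree's named facts `ribet1997_twoPowerFermat` (Ribet 1997, Thm. 3) and
`darmonMerel1997_denesEquation` (Darmon–Merel 1997) — via
`IsFreyHellegouarch.ordCompl_two_minimalDiscriminantNorm_ne_pow_of_five_le`, leaving only its case
`ℓ = 3` (`h612₃`: the odd part of `|Δ_min|` of a Frey–Hellegouarch curve with an odd bad prime is not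
a cube; Euler `x³ + y³ = 2z³`, Legendre `x³ + y³ = 4z³` — in neither Mathlib nor the tree) as a
hypothesis. So `PastenShimura2024_thm_6_1_b_holds` waits exactly for: the named facts
`mazurKenku_exists_cyclic_isogeny`, `mestreOesterle1989_thm_1`, `nonempty_shimuraParametrizationData`,
`ribet1997_twoPowerFermat`, `darmonMerel1997_denesEquation`, Mathlib's `FermatLastTheorem`; the
component-group package over Néron models of `J₀^D(M)` (`cI cJ hI hJ`, `h613` = Ribet–Takahashi 1997
Thm. 2, `hJc`, `hEis`, `h67`), which has no vocabulary in the tree; and `h612₃`.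
[cite: PastenShimura2024, Thm. 6.1 (b) p. 20, §6.3–6.9 pp. 21–25] [cite: RibetTakahashi1997, Thm. 2] [cite: MestreOesterle1989, §4 Théorème 1] [cite: Ribet1997, Thm. 3] [cite: DarmonMerel1997, Main Theorem (1)] -/
theorem PastenShimura2024_thm_6_1_b_of_ribetTakahashi_treeFacts''
    (hMK : mazurKenku_exists_cyclic_isogeny) (hMO : mestreOesterle1989_thm_1)
    (hP : nonempty_shimuraParametrizationData)
    (hRib : ribet1997_twoPowerFermat) (hDM : darmonMerel1997_denesEquation)
    (hFLT : FermatLastTheorem)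
    (cI cJ : ∀ {D M : ℕ} {X : ShimuraCurveData D M} {W' : WeierstrassCurve ℚ},
      ShimuraParametrizationData X W' → ℕ → ℕ)
    (hI : ∀ {D M : ℕ} {X : ShimuraCurveData D M} {W' : WeierstrassCurve ℚ}
      (P : ShimuraParametrizationData X W') (p : ℕ), 0 < cI P p)
    (hJ : ∀ {D M : ℕ} {X : ShimuraCurveData D M} {W' : WeierstrassCurve ℚ}
      (P : ShimuraParametrizationData X W') (p : ℕ), 0 < cJ P p)
    (h613 : ∀ {N d M₁ D M p r : ℕ}, p.Prime → r.Prime → p ≠ r → D = d * (p * r) →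
      M₁ = p * r * M → IsAdmissibleFactorization N D M →
      ∀ (X₁ : ShimuraCurveData d M₁) (X₂ : ShimuraCurveData D M)
        (W : WeierstrassCurve ℚ) [W.IsElliptic] [W.IsGloballyMinimal], W.conductorNorm ℤ = N →
      ∀ (W₁' : WeierstrassCurve ℚ) [W₁'.IsElliptic] (P₁ : ShimuraParametrizationData X₁ W₁'),
        P₁.IsMinimalFor W →
      ∀ (W₂' : WeierstrassCurve ℚ) [W₂'.IsElliptic] (P₂ : ShimuraParametrizationData X₂ W₂'),
        P₂.IsMinimalFor W →
        P₁.deg * (cI P₁ p ^ 2 * cJ P₂ r ^ 2) =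
          P₂.deg * ((W₁'.minimalDiscriminantNorm ℤ).factorization p *
            (W₂'.minimalDiscriminantNorm ℤ).factorization r))
    (hJc : ∀ {N D M : ℕ}, IsAdmissibleFactorization N D M →
      ∀ (X : ShimuraCurveData D M) (W : WeierstrassCurve ℚ) [W.IsElliptic] [W.IsGloballyMinimal],
        W.conductorNorm ℤ = N →
      ∀ (W' : WeierstrassCurve ℚ) [W'.IsElliptic] (P : ShimuraParametrizationData X W'),
        P.IsMinimalFor W → ∀ p : ℕ, p.Prime → p ∣ D →
        cJ P p ∣ (W'.minimalDiscriminantNorm ℤ).factorization p)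
    {S : Finset ℕ} (h2S : 2 ∈ S)
    (hEis : ∀ {N D M : ℕ}, IsAdmissibleFactorization N D M →
      ∀ (X : ShimuraCurveData D M) (W : WeierstrassCurve ℚ) [W.IsElliptic] [W.IsGloballyMinimal],
        W.conductorNorm ℤ = N →
      ∀ (W' : WeierstrassCurve ℚ) [W'.IsElliptic] (P : ShimuraParametrizationData X W'),
        P.IsMinimalFor W → ∀ p : ℕ, p.Prime → p ∣ M → ¬ p ^ 2 ∣ M →
        ∀ r : ℕ, r.Prime → ¬ r ∣ N → (cI P p : ℤ) ∣ (r + 1 : ℤ) - W'.LFunction r)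
    (h67 : ∀ ℓ : ℕ, ℓ.Prime → ∃ β : ℕ, (163 < ℓ → β = 1) ∧
      ∀ (A : WeierstrassCurve ℚ) [A.IsElliptic],
        (∀ q : ℕ, q.Prime → q ∉ S → ¬ q ^ 2 ∣ A.conductorNorm ℤ) →
        ∀ r₀ : ℕ, ∃ r : ℕ, r₀ < r ∧ r.Prime ∧ ¬ ((ℓ ^ β : ℕ) : ℤ) ∣ (r + 1 : ℤ) - A.LFunction r)
    (h612₃ : ∀ (W : WeierstrassCurve ℚ) [W.IsElliptic], IsFreyHellegouarch W →
      (∃ q : ℕ, q.Prime ∧ q ≠ 2 ∧ q ∣ W.conductorNorm ℤ) →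
      ∀ k : ℕ, ordCompl[2] (W.minimalDiscriminantNorm ℤ) ≠ k ^ 3) :
    PastenShimura2024_thm_6_1_b := by
  obtain ⟨κ₁, hκ₁, hκ₁', h614⟩ := PastenShimura2024_lemma_6_14 cI hI hEis h67
  refine PastenShimura2024_thm_6_1_b_of_ribetTakahashi_mestreOesterle_fermatQuartic cI cJ hI hJ h613 hJc
    (fun W W' _ _ hiso p hp hpN hp2 =>
      lemma_6_8_factorization_form (PastenShimura2024_lemma_6_8_of_mazurKenku' hMK) W W' hiso p hp
        hpN hp2)
    (Nat.one_le_iff_ne_zero.mp hκ₁ |> Nat.pos_of_ne_zero) h614 hMO hP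
    (fun _X _W _ _ _hN _hcl _W₁ _ D₁ hf hmin _W' _ _P hP => hP.deg_dvd_modularDegree D₁ hf hmin)
    hκ₁' h2S ?_
  -- Lemma 6.12: `ℓ = 3` as given, `ℓ ≥ 5` from Wiles, Ribet, Darmon–Merel
  intro W _ hFH hodd ℓ hℓ h3 k
  by_cases h5 : 5 ≤ ℓ
  · exact IsFreyHellegouarch.ordCompl_two_minimalDiscriminantNorm_ne_pow_of_five_le hRib hDM hℓ h5
      (hFLT ℓ (by omega)) hFH hodd k
  · have h4 : ℓ ≠ 4 := fun h => by norm_num [h] at hℓ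
    have hℓ3 : ℓ = 3 := by omega
    subst hℓ3
    exact h612₃ W hFH hodd k


end Literature.NumberTheory.Automorphic

end
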